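import Mathlib
import Literature.Analysis.FluidPDE.ClassicalSolution
import Literature.Analysis.FluidPDE.LerayHopf
import Literature.Analysis.FluidPDE.NSWave0
import Summits.NavierStokesRegularity.NavierStokesRegularity.Theses.L3TimeExponentPincer
import Summits.NavierStokesRegularity.NavierStokesRegularity.Theorems.L3TimeExponentPincerJawSuperEuler
import HarnessLib

/-!
# Spatial localisation of crux `L3CascadeJaw` (stmt-NavierStokesRegularity-19499) under a far-field bound:
# the jaw is decided inside a fixed ball

Support file (cell ns-regularity-ideate, seat ns-pincer-19499-p1 g2), fifth after the localisation triple
(`…JawSuperEuler` p471620 — SPEED, `…JawSubEulerEddy` p473776 — SCALE, `…JawEulerBox` p475049 — TIME × SPEED ×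
SCALE) and the residual bridge (`…SerrinEulerBridge`).  The fourth coordinate is POSITION.  A frame solution that is
BOUNDED ON THE FAR FIELD near `T` — `|u(t,x)| ≤ B` for `|x| > R`, `t ∈ (T₁,T)`, the conclusion of the far-field
regularity theorems for Leray / local-energy solutions (Caffarelli–Kohn–Nirenberg 1982 Thm C–D; Lemarié-Rieusset
2016 Thm 14.5; Bradshaw–Tsai 2020; in the tree as the named fact
`Literature.Analysis.FluidPDE.leray_solution_farField_bound` over the local-Leray class) — has its super-Euler-speed
set `{|u(t,·)| > (T-t)^{-3/5}}` inside the closed ball `B̄(0,R)` as soon as `(T-t)^{-3/5} > B`; by the speed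
localisation (`jawClauseAt_iff_superEuler`, p471620) the clause of the crux is then EQUIVALENT to the clause for the
local `L³` norm on `B̄(0,R)`.  Kernel-checked, unconditional AS IMPLICATIONS (the far-field bound is an explicit
hypothesis, not a named fact):

* `superEuler_subset_closedBall_of_farFieldBound` — the geometric step;
* `jawClauseAt_iff_local_of_farFieldBound` — per solution, `0 ≤ q < 5`: the clause at `q` ⟺
  `∫_{T₂}^T (∫_{B̄(0,R)} |u(t)|³)^{q/3} dt < ∞` on a final window;
* `l3CascadeJaw_iff_local_of_farFieldBounded` — if EVERY frame solution is far-field bounded near `T` (the expected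
  frame-level far-field theorem, here a hypothesis spelled out), the crux BY NAME ⟺ its local form.

So, modulo far-field regularity of the frame, the crux lives on the compact Euler cell
`(T₂,T)_fast × B̄(0,R) ∩ {|w| > U_E} ∩ {scales < r_E}`.

WHAT THIS IS NOT: not a claim about Navier–Stokes regularity or blow-up; the far-field bound is ASSUMED per
solution (its frame-level proof — local-Leray bridge + `leray_solution_farField_bound` — is not attempted here);
landed `--supports stmt-NavierStokesRegularity-19499`.
-/

noncomputable section

namespace Summit.NavierStokesRegularity.NavierStokesRegularity.Theorems.L3TimeExponentPincerJawFarFieldLocal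

open MeasureTheory Set Function Filter Metric Topology
open scoped ENNReal NNReal
open Literature.Analysis.FluidPDE
open Summit.NavierStokesRegularity.NavierStokesRegularity.Theses.L3TimeExponentPincer (L3CascadeJaw)
open Summit.NavierStokesRegularity.NavierStokesRegularity.Theorems.L3TimeExponentPincerJawFullMorrey
  (eLpNorm_three_rpow_eq)
open Summit.NavierStokesRegularity.NavierStokesRegularity.Theorems.L3TimeExponentPincerJawSuperEuler
  (jawClauseAt_iff_superEuler)

/-! ## §1  Geometry: under a far-field bound the super-Euler set sits in a fixed ball -/

/-- If `|v(x)| ≤ B` for `|x| > R` and the threshold `λ` exceeds `B`, then `{|v| > λ} ⊆ B̄(0,R)`. [folklore] -/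
theorem superLevel_subset_closedBall {v : EuclideanSpace ℝ (Fin 3) → EuclideanSpace ℝ (Fin 3)} {R B l : ℝ}
    (hfar : ∀ x, R < ‖x‖ → ‖v x‖ ≤ B) (hl : B < l) :
    {y | l < ‖v y‖} ⊆ closedBall (0 : EuclideanSpace ℝ (Fin 3)) R := by
  intro y hy
  rw [mem_closedBall, dist_zero_right]
  by_contra hR
  exact absurd ((hfar y (not_le.1 hR)).trans_lt hl) (not_lt.2 (le_of_lt hy))

/-- The Euler-speed threshold beats any bound near `T`: for `0 < T - t < (B+1)^{-5/3}` one has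
`B < (T-t)^{-3/5}`. -/
theorem lt_eulerThreshold_of_close {B T t : ℝ} (hB : 0 ≤ B) (ht : t < T)
    (hclose : T - t < (B + 1) ^ (-(5 / 3 : ℝ))) : B < 1 * (T - t) ^ (-(3 / 5 : ℝ)) := by
  have hs : 0 < T - t := sub_pos.2 ht
  have hB1 : 0 < B + 1 := by linarith
  rw [one_mul]
  calc B < B + 1 := by linarith
    _ = ((B + 1) ^ (-(5 / 3 : ℝ))) ^ (-(3 / 5 : ℝ)) := by
        rw [← Real.rpow_mul hB1.le]; norm_num
    _ < (T - t) ^ (-(3 / 5 : ℝ)) := Real.rpow_lt_rpow_of_neg hs hclose (by norm_num)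

/-- **Far-field bound ⇒ the super-Euler set lies in `B̄(0,R)` near `T`.**  If `|u(t,x)| ≤ B` for `|x| > R` and
`t ∈ (T₁,T)`, then for `t ∈ (T₁,T)` with `T - t < (B+1)^{-5/3}`: `{x : |u(t,x)| > (T-t)^{-3/5}} ⊆ B̄(0,R)`. -/
theorem superEuler_subset_closedBall_of_farFieldBound
    {u : ℝ → EuclideanSpace ℝ (Fin 3) → EuclideanSpace ℝ (Fin 3)} {T R B T₁ : ℝ} (hB : 0 ≤ B)
    (hfar : ∀ t ∈ Ioo T₁ T, ∀ x, R < ‖x‖ → ‖u t x‖ ≤ B)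
    {t : ℝ} (ht : t ∈ Ioo T₁ T) (hclose : T - t < (B + 1) ^ (-(5 / 3 : ℝ))) :
    {y | 1 * (T - t) ^ (-(3 / 5 : ℝ)) < ‖u t y‖} ⊆ closedBall (0 : EuclideanSpace ℝ (Fin 3)) R :=
  superLevel_subset_closedBall (hfar t ht) (lt_eulerThreshold_of_close hB ht.2 hclose)

/-! ## §2  The clause ⟺ the local clause on `B̄(0,R)` -/

/-- **Spatial localisation of the clause under a far-field bound.**  For a frame solution with `|u(t,x)| ≤ B` for
`|x| > R`, `t ∈ (T₁,T)`, and `0 ≤ q < 5`: `∫_{T₂}^T ‖u(t)‖₃^q dt < ∞` on some final window ⟺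
`∫_{T₂}^T (∫_{B̄(0,R)} |u(t)|³)^{q/3} dt < ∞` on some final window.  (⇒: monotonicity; ⇐: near `T` the super-Euler
set is inside `B̄(0,R)`, so its `L³`-mass is at most the local one, and the speed localisation
`jawClauseAt_iff_superEuler` concludes.) -/
theorem jawClauseAt_iff_local_of_farFieldBound {ν T : ℝ} (hν : 0 < ν)
    {u : ℝ → EuclideanSpace ℝ (Fin 3) → EuclideanSpace ℝ (Fin 3)} {p : ℝ → EuclideanSpace ℝ (Fin 3) → ℝ}
    (hcl : IsClassicalNSSolutionOn (Ico 0 T) ν 0 u p) (hLH : IsLerayHopfOn T ν 0 (u 0) u)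
    {R B T₁ : ℝ} (hB : 0 ≤ B) (hT₁ : T₁ < T)
    (hfar : ∀ t ∈ Ioo T₁ T, ∀ x, R < ‖x‖ → ‖u t x‖ ≤ B)
    {q : ℝ} (hq0 : 0 ≤ q) (hq5 : q < 5) :
    (∃ T₂ ∈ Ioo 0 T, (∫⁻ t in Ioo T₂ T, eLpNorm (u t) 3 volume ^ q) < ⊤) ↔
      ∃ T₂ ∈ Ioo 0 T, (∫⁻ t in Ioo T₂ T,
        (∫⁻ x in closedBall (0 : EuclideanSpace ℝ (Fin 3)) R, ‖u t x‖ₑ ^ 3) ^ (q / 3)) < ⊤ := by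
  have hq3 : 0 ≤ q / 3 := by positivity
  constructor
  · rintro ⟨T₂, hT₂, hfin⟩
    refine ⟨T₂, hT₂, lt_of_le_of_lt (lintegral_mono fun t => ?_) hfin⟩
    rw [eLpNorm_three_rpow_eq]
    exact ENNReal.rpow_le_rpow (setLIntegral_le_lintegral _ _) hq3
  · rintro ⟨T₂, hT₂, hfin⟩
    refine (jawClauseAt_iff_superEuler hν hcl hLH zero_le_one (le_refl (3 / 5 : ℝ)) hq0 hq5).2 ?_
    -- a final window on which the super-Euler set is inside the ball
    have hδ : 0 < (B + 1) ^ (-(5 / 3 : ℝ)) := Real.rpow_pos_of_pos (by linarith) _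
    set T₃ : ℝ := max (max T₂ T₁) (T - (B + 1) ^ (-(5 / 3 : ℝ))) with hT₃
    have hT₃mem : T₃ ∈ Ioo 0 T :=
      ⟨lt_max_of_lt_left (lt_max_of_lt_left hT₂.1), max_lt (max_lt hT₂.2 hT₁) (by linarith)⟩
    refine ⟨T₃, hT₃mem, ?_⟩
    have hsub : ∀ t ∈ Ioo T₃ T,
        (∫⁻ x in {y | 1 * (T - t) ^ (-(3 / 5 : ℝ)) < ‖u t y‖}, ‖u t x‖ₑ ^ 3) ^ (q / 3) ≤
          (∫⁻ x in closedBall (0 : EuclideanSpace ℝ (Fin 3)) R, ‖u t x‖ₑ ^ 3) ^ (q / 3) := by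
      intro t ht
      have ht₁ : t ∈ Ioo T₁ T := ⟨((le_max_right _ _).trans (le_max_left _ _)).trans_lt ht.1, ht.2⟩
      have hclose : T - t < (B + 1) ^ (-(5 / 3 : ℝ)) := by
        have := (le_max_right (max T₂ T₁) (T - (B + 1) ^ (-(5 / 3 : ℝ)))).trans_lt ht.1
        linarith
      exact ENNReal.rpow_le_rpow
        (lintegral_mono_set (superEuler_subset_closedBall_of_farFieldBound hB hfar ht₁ hclose)) hq3
    calc ∫⁻ t in Ioo T₃ T, (∫⁻ x in {y | 1 * (T - t) ^ (-(3 / 5 : ℝ)) < ‖u t y‖}, ‖u t x‖ₑ ^ 3) ^ (q / 3)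
        ≤ ∫⁻ t in Ioo T₃ T, (∫⁻ x in closedBall (0 : EuclideanSpace ℝ (Fin 3)) R, ‖u t x‖ₑ ^ 3) ^ (q / 3) :=
          setLIntegral_mono' measurableSet_Ioo hsub
      _ ≤ ∫⁻ t in Ioo T₂ T, (∫⁻ x in closedBall (0 : EuclideanSpace ℝ (Fin 3)) R, ‖u t x‖ₑ ^ 3) ^ (q / 3) :=
          lintegral_mono_set (Ioo_subset_Ioo_left ((le_max_left _ _).trans (le_max_left _ _)))
      _ < ⊤ := hfin

/-! ## §3  The crux BY NAME ⟺ its local form, modulo far-field boundedness of the frame -/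

/-- **`L3CascadeJaw` ⟺ its local form, given far-field boundedness of every frame solution.**  Hypothesis
(spelled out; the frame-level far-field regularity theorem): every frame solution is bounded on some far field
`{|x| > R} × (T₁,T)`.  Conclusion: the crux holds iff for every `q ∈ (4,5)`, every frame solution and every
far-field datum `(R, B, T₁)` of it, the LOCAL clause `∫_{T₂}^T (∫_{B̄(0,R)} |u(t)|³)^{q/3} dt < ∞` holds on a final
window.  (The forward direction does not use the hypothesis.) -/
theorem l3CascadeJaw_iff_local_of_farFieldBounded
    (hFF : ∀ (ν T : ℝ), 0 < ν → 0 < T →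
      ∀ (u : ℝ → EuclideanSpace ℝ (Fin 3) → EuclideanSpace ℝ (Fin 3)) (p : ℝ → EuclideanSpace ℝ (Fin 3) → ℝ),
        IsClassicalNSSolutionOn (Ico 0 T) ν 0 u p → IsLerayHopfOn T ν 0 (u 0) u → HasRapidSpatialDecay (u 0) →
        ∃ R B T₁ : ℝ, 0 ≤ B ∧ T₁ < T ∧ ∀ t ∈ Ioo T₁ T, ∀ x, R < ‖x‖ → ‖u t x‖ ≤ B) :
    L3CascadeJaw ↔
      ∀ q : ℝ, 4 < q → q < 5 → ∀ (ν T : ℝ), 0 < ν → 0 < T →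
        ∀ (u : ℝ → EuclideanSpace ℝ (Fin 3) → EuclideanSpace ℝ (Fin 3)) (p : ℝ → EuclideanSpace ℝ (Fin 3) → ℝ),
          IsClassicalNSSolutionOn (Ico 0 T) ν 0 u p → IsLerayHopfOn T ν 0 (u 0) u →
          HasRapidSpatialDecay (u 0) →
          ∀ R B T₁ : ℝ, 0 ≤ B → T₁ < T → (∀ t ∈ Ioo T₁ T, ∀ x, R < ‖x‖ → ‖u t x‖ ≤ B) →
            ∃ T₂ ∈ Ioo 0 T, (∫⁻ t in Ioo T₂ T,
              (∫⁻ x in closedBall (0 : EuclideanSpace ℝ (Fin 3)) R, ‖u t x‖ₑ ^ 3) ^ (q / 3)) < ⊤ := by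
  unfold L3CascadeJaw
  constructor
  · intro h q hq4 hq5 ν T hν hT u p hcl hLH hdec R B T₁ hB hT₁ hfar
    exact (jawClauseAt_iff_local_of_farFieldBound hν hcl hLH hB hT₁ hfar (by linarith) hq5).1
      (h q hq4 hq5 ν T hν hT u p hcl hLH hdec)
  · intro h q hq4 hq5 ν T hν hT u p hcl hLH hdec
    obtain ⟨R, B, T₁, hB, hT₁, hfar⟩ := hFF ν T hν hT u p hcl hLH hdec
    exact (jawClauseAt_iff_local_of_farFieldBound hν hcl hLH hB hT₁ hfar (by linarith) hq5).2
      (h q hq4 hq5 ν T hν hT u p hcl hLH hdec R B T₁ hB hT₁ hfar)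

end Summit.NavierStokesRegularity.NavierStokesRegularity.Theorems.L3TimeExponentPincerJawFarFieldLocal

end
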